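import Summits.BirchSwinnertonDyer.Rank1Residual.X11b.Three.StepLHalvesAntiVacuity
import Summits.BirchSwinnertonDyer.Rank1Residual.X11b.RouteR1BDPExists
import Literature.FieldTheory.AlgClosed.PadicAlgClEquivComplex
import HarnessLib

/-!
# X11b @ `p = 3`, S22: the GLUE between S0's datum (H1 = `Three.BDPExistsAt₃`) and an existence fact
# in the binder shape of `castella2018_exists_isBDPLFunction` (team N8/O2 = cell `b2b-bsdres`,
# sub-target S22 for S18(b), seat x11b3-p6)

HONEST FRAMING (cell `b2b-bsdres`, run/shared/lean/b2b/bsd-rank1-residual/, verbatim in every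
file): the goal of the cell is to DELETE the COMBINATION-SHAPED residual classes of the
Birch–Swinnerton-Dyer formula for ALL analytic-rank `≤ 1` elliptic curves over `ℚ` — assembled
STRICTLY from published theorems — so that the rank-`≤ 1` remainder becomes exactly the
CONSTRUCTION-SHAPED classes, which are TYPED, NOT attempted. This is not "finishing BSD". Team N8/O2
(X11b at `3`; §I O2 OPEN; X11 ∧ r = 1 ∧ p = 3 CONSTRUCTION-SHAPED). Research route; nothing booked;
NO label changes. THEOREMS ONLY: no definition, no named fact, no `sorry`. NOTHING is discharged
here: H1 stays a HALVES binder until S18 lands a PRINTED fact (lit1's pen) of the shape below.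

## What this file proves (lead R7-22, S22 (i)–(v) + the assembly)

H1 = `Three.BDPExistsAt₃ W` (`StepLHalves.lean`) quantifies over S0's datum `(N, K, Dt, H, ι, P, κ,
γ, 𝔭, f)` and asks for an embedding datum `ι' : ℚ̄₃ ≃ ℂ` inducing `𝔭` and a frame `(Ω_K, Ω_p, L)`
with `IsBDPLFunction ι' 𝔭 κ γ f Ω_K Ω_p L`. A published existence theorem enters the tree in the
binder shape of `castella2018_exists_isBDPLFunction` (Cas18 Thm. 3.1, `5 ≤ p`, `Squarefree N`): for
EVERY datum `ι'`, under (irr), `K` imaginary quadratic with `p` split, `p ∈ 𝔭`, the compatibility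
clause `k ∈ 𝔭 ↔ |ι'⁻¹(k)|_p < 1`, the (Heeg) clause "every `ℓ ∣ N` has a prime of norm `ℓ`",
`κ` anticyclotomic with generator `γ`. The glue, hypothesis by hypothesis:

* (i) `ncard_primesOver_three_eq_two_of_classX11b` — on S0's datum `3` SPLITS in `K`: `3 ∣ N`
  (`ClassX11b W 3` is multiplicative at `3`, `dvd_conductorNorm_of_mult`) and
  `SatisfiesHeegnerHypothesis N K` says every prime of `N` has two primes above it;
* (ii) `inducesPrime_iff` — `Three.InducesPrime ι' 𝔭` IS the fact's compatibility clause
  (`Iff.rfl`); the datum `ι'` itself comes from `Three.exists_inducesPrime` (p7, anti-vacuity leaf)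
  applied to ANY `ι₀ : ℚ̄₃ ≃+* ℂ`, which exists (`PadicAlgCl.nonempty_ringEquiv_complex`, Steinitz);
* (iii) `forall_exists_absNorm_eq_of_satisfiesHeegnerHypothesis` — the classical Heegner hypothesis
  gives the fact's (Heeg) clause (`X11b.exists_absNorm_eq_of_splitsIn`, multr1-p1);
* (iv) `hasIrreducibleModPGaloisRep_of_classX11b` — `ClassX11b W p → W.HasIrreducibleModPGaloisRep p`
  (the `Irr` conjunct);
* (v) `isTopGenerator_of_fact` — `[Fact (κ.IsTopGenerator γ)] → κ.IsTopGenerator γ`;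
* **`bdpExistsAt₃_of_forall_exists_isBDPLFunction`** — THE ASSEMBLY: any statement "for every datum
  `ι'` and every S0-datum satisfying ⟨the fact-shaped clauses at `p = 3`⟩ there is a frame with
  `IsBDPLFunction`" implies `BDPExistsAt₃ W`. The antecedent offers the consumer EVERY hypothesis
  S0's datum carries (newform, `ClassX11b W 3`, `Surj W 3`, `N = N_E`, `K` imaginary quadratic,
  `d_K` odd, Heegner hypothesis, `3` split, `3 ∈ 𝔭`, `e(𝔭|3) = f(𝔭|3) = 1`, compatibility clause,
  (Heeg) clause, `κ` anticyclotomic, `γ` a generator), so S18(b)'s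
  `Three.bdpExistsAt₃_of_hsieh2014 (hH : hsieh2014_exists_isBDPLFunction)` is ONE application of
  this theorem to `hH` — whatever subset of these clauses the printed fact finally carries — and
  `Three.bsdp_of_halves₃_onA1` (p2, `CharTorsionOnA1.lean`) then drops `h1`.

Nothing here depends on the final wording of the S18 fact; if lit1/r2 KILL S18 (Hsieh 2014 Thm. 1's
(ord) excluding `π₃ = St`, or an unprinted step at `3 ∣ N`), this file stays a harmless adapter and
H1 stays typed. Axioms: `propext`, `Classical.choice`, `Quot.sound`.

## References

* [Castella2018] F. Castella, Camb. J. Math. 6 (2018), Thm. 3.1 and §3 (arXiv:1704.06608 p. 9):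
  the binder shape (`castella2018_exists_isBDPLFunction`).
* [Hsieh2014] M.-L. Hsieh, Doc. Math. 19 (2014), Thm. 1 / Thm. A (arXiv:1112.1580 pp. 3–4): the
  source S18 types (lit1 L54 = (D-ii)).
* [GrossLMS1991] B. H. Gross, *Kolyvagin's work on modular elliptic curves*, §1 (p. 235): the
  Heegner hypothesis.
* Cell files: `cells/x11b3/OWNERS.md` R7-22 (S18 / S22), `cells/x11b3/LINE-W.md` W2-int.
-/

noncomputable section

open scoped Classical

open WeierstrassCurve NumberField IsDedekindDomain Field
  Literature.NumberTheory.EllipticCurves Literature.NumberTheory.EllipticCurves.ModularForms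
  Literature.NumberTheory.EllipticCurves.Rank1Residual
  Literature.NumberTheory.GaloisRepresentations

namespace Summit.BirchSwinnertonDyer.Rank1Residual.X11b.Three

/-! ### (i)–(v): the clauses of the fact, from S0's datum -/

section Clauses

/-- **(i) On S0's datum `3` splits in `K`**: `ClassX11b W 3` is multiplicative at `3`, so `3 ∣ N_E`
(`dvd_conductorNorm_of_mult`), and the classical Heegner hypothesis for `(N_E, K)` gives two primes
of `K` above `3` — the "`p = 𝔭𝔭̄` split" clause of the fact. [cite: GrossLMS1991, §1 (p. 235)] -/
theorem ncard_primesOver_three_eq_two_of_classX11b {W : WeierstrassCurve ℚ} [W.IsElliptic]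
    [W.IsGloballyMinimal] [Fact (Nat.Prime 3)] {K : Type} [Field K] (hX : ClassX11b W 3) {N : ℕ}
    (hN : W.conductorNorm ℤ = N) (hH : SatisfiesHeegnerHypothesis N K) :
    ((Ideal.span {(3 : ℤ)}).primesOver (𝓞 K)).ncard = 2 :=
  hH 3 Nat.prime_three (hN ▸ dvd_conductorNorm_of_mult hX.2.2.1)

/-- **(ii) `InducesPrime ι' 𝔭` IS the fact's compatibility clause** `k ∈ 𝔭 ↔ |ι'⁻¹(w(k))|₃ < 1` for
every infinite place `w` (definitional). [cite: Castella2018, Thm. 3.1 (arXiv:1704.06608 p. 9) (compatibility clause)] -/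
theorem inducesPrime_iff {K : Type} [Field K] [NumberField K] (ι' : PadicAlgCl 3 ≃+* ℂ)
    (𝔭 : HeightOneSpectrum (𝓞 K)) :
    InducesPrime ι' 𝔭 ↔
      ∀ (w : InfinitePlace K) (k : 𝓞 K), k ∈ 𝔭.asIdeal ↔ ‖ι'.symm (w.embedding (k : K))‖ < 1 :=
  Iff.rfl

/-- **(ii′) A datum inducing `𝔭` EXISTS** for every prime `𝔭 ∋ 3` of an imaginary quadratic `K`, with
no input datum: some `ι₀ : ℚ̄₃ ≃+* ℂ` exists (Steinitz, `PadicAlgCl.nonempty_ringEquiv_complex`) and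
`ι₀` or `ι₀ ∘ conj` induces `𝔭` (`Three.exists_inducesPrime`, p7). [folklore] -/
theorem exists_inducesPrime' {K : Type} [Field K] [NumberField K] (hK : IsImaginaryQuadratic K)
    {𝔭 : HeightOneSpectrum (𝓞 K)} (h𝔭 : ((3 : ℕ) : 𝓞 K) ∈ 𝔭.asIdeal) :
    ∃ ι' : PadicAlgCl 3 ≃+* ℂ, InducesPrime ι' 𝔭 := by
  haveI : Fact (Nat.Prime 3) := ⟨Nat.prime_three⟩
  obtain ⟨ι₀⟩ := PadicAlgCl.nonempty_ringEquiv_complex 3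
  exact exists_inducesPrime hK h𝔭 ι₀

/-- **(iii) The classical Heegner hypothesis gives the fact's (Heeg) clause**: if every prime of `N`
splits in the quadratic field `K`, every prime `ℓ ∣ N` has a prime of `𝓞 K` of norm `ℓ`
(`X11b.exists_absNorm_eq_of_splitsIn`: split ⇒ `e = f = 1` ⇒ `N(𝔩) = ℓ`).
[cite: GrossLMS1991, §1 (p. 235)] [cite: Castella2018, §3 (arXiv:1704.06608 p. 9), (Heeg)] -/
theorem forall_exists_absNorm_eq_of_satisfiesHeegnerHypothesis {K : Type} [Field K] [NumberField K]
    (h2 : Module.finrank ℚ K = 2) {N : ℕ} (hH : SatisfiesHeegnerHypothesis N K) :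
    ∀ ℓ : ℕ, ℓ.Prime → ℓ ∣ N → ∃ v : HeightOneSpectrum (𝓞 K), Ideal.absNorm v.asIdeal = ℓ :=
  fun ℓ hℓ hℓN ↦ exists_absNorm_eq_of_splitsIn h2 hℓ (hH ℓ hℓ hℓN)

/-- **(iv) `ClassX11b W p → E[p]` irreducible** (the `Irr` conjunct, in the fact's spelling
`W.HasIrreducibleModPGaloisRep p`). [folklore] -/
theorem hasIrreducibleModPGaloisRep_of_classX11b {W : WeierstrassCurve ℚ} [W.IsElliptic] {p : ℕ}
    [Fact p.Prime] (hX : ClassX11b W p) : W.HasIrreducibleModPGaloisRep p :=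
  hX.2.2.2

/-- **(v) the generator clause** from the instance binder `[Fact (κ.IsTopGenerator γ)]` of S0's
datum. [folklore] -/
theorem isTopGenerator_of_fact {K : Type} [Field K] {p : ℕ} [Fact p.Prime] {κ : ZpExtension K p}
    {γ : Field.absoluteGaloisGroup K} [h : Fact (κ.IsTopGenerator γ)] : κ.IsTopGenerator γ :=
  h.out

end Clauses

/-! ### The assembly: a fact in Castella's binder shape at `p = 3` discharges H1 -/

section Assembly

variable (W : WeierstrassCurve ℚ) [W.IsElliptic] [W.IsGloballyMinimal]

/-- **S22 ASSEMBLY: an existence statement in the binder shape of `castella2018_exists_isBDPLFunction`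
at `p = 3` discharges H1 = `BDPExistsAt₃ W`.** The antecedent `hfact` is offered EVERY clause S0's
datum provides — the newform `f` of `E`, `ClassX11b W 3`, `Surj W 3`, `N = N_E`, `K` imaginary
quadratic with `d_K` odd and the classical Heegner hypothesis for `N`, `3` split in `K`, `3 ∈ 𝔭`,
`e(𝔭|3) = f(𝔭|3) = 1`, the compatibility clause of the datum `ι'`, the (Heeg) clause "every `ℓ ∣ N`
has a prime of norm `ℓ`", `κ` anticyclotomic, `γ` a topological generator — and must return a frame
`(Ω_K ≠ 0, Ω_p ∈ R₀ˣ, L)` with `IsBDPLFunction ι' 𝔭 κ γ f Ω_K Ω_p L`. Proof: pick ANY `ι₀ : ℚ̄₃ ≃ ℂ`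
(Steinitz), replace it by the datum `ι'` inducing `𝔭` (`exists_inducesPrime`), and feed `hfact` with
(i)–(v). S18(b) = this theorem applied to the printed fact (lit1's pen); nothing is discharged HERE.
[cite: Castella2018, Thm. 3.1 (arXiv:1704.06608 p. 9) (binder shape only)] -/
theorem bdpExistsAt₃_of_forall_exists_isBDPLFunction [Fact (Nat.Prime 3)]
    (hfact : ∀ (ι' : PadicAlgCl 3 ≃+* ℂ) (K : Type) [Field K] [NumberField K]
      (𝔭 : HeightOneSpectrum (𝓞 K)) (κ : ZpExtension K 3) (γ : Field.absoluteGaloisGroup K)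
      {N : ℕ} [NeZero N] {f : CuspForm (CongruenceSubgroup.Gamma0 N) 2}, IsNewformOf W f →
      ClassX11b W 3 → Surj W 3 → W.conductorNorm ℤ = N → IsImaginaryQuadratic K →
      Odd (NumberField.discr K) → SatisfiesHeegnerHypothesis N K →
      ((Ideal.span {(3 : ℤ)}).primesOver (𝓞 K)).ncard = 2 → ((3 : ℕ) : 𝓞 K) ∈ 𝔭.asIdeal →
      𝔭.asIdeal.ramificationIdx (𝓞 ℚ) = 1 → 𝔭.asIdeal.inertiaDeg (𝓞 ℚ) = 1 →
      (∀ (w : InfinitePlace K) (k : 𝓞 K), k ∈ 𝔭.asIdeal ↔ ‖ι'.symm (w.embedding (k : K))‖ < 1) →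
      (∀ ℓ : ℕ, ℓ.Prime → ℓ ∣ N → ∃ v : HeightOneSpectrum (𝓞 K), Ideal.absNorm v.asIdeal = ℓ) →
      κ.IsAnticyclotomic → κ.IsTopGenerator γ →
      ∃ (ΩK : ℂ) (Ωp : (unrIntegers 3)ˣ) (L : UnrSeries 3),
        ΩK ≠ 0 ∧ IsBDPLFunction ι' 𝔭 κ γ f ΩK ((Ωp : unrIntegers 3) : ℂ_[3]) L) :
    BDPExistsAt₃ W := by
  intro N _ K _ _ Dt H ι P hX hsurj hN hK hodd hH hL1 hP hc hP0 κ hκ γ hγ 𝔭 h𝔭 he hf f hnf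
  obtain ⟨ι', hι'⟩ := exists_inducesPrime' hK h𝔭
  exact ⟨ι', hι', hfact ι' K 𝔭 κ γ hnf hX hsurj hN hK hodd hH
    (ncard_primesOver_three_eq_two_of_classX11b hX hN hH) h𝔭 he hf hι'
    (forall_exists_absNorm_eq_of_satisfiesHeegnerHypothesis hK.1 hH) hκ hγ.out⟩

/-- **The minimal shape suffices**: a fact that uses ONLY Castella's own clauses at `p = 3` (datum
`ι'`, newform, (irr), `K` imaginary quadratic, `3` split, `3 ∈ 𝔭`, compatibility, (Heeg),
anticyclotomic `κ`, generator `γ`) — i.e. `castella2018_exists_isBDPLFunction` with `5 ≤ p → Squarefree N`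
replaced by whatever the `p = 3 ∣ N` source prints and is discharged from `ClassX11b W 3` — discharges
H1. This is the intended one-line use in S18(b). [cite: Castella2018, Thm. 3.1 (arXiv:1704.06608 p. 9) (binder shape only)] -/
theorem bdpExistsAt₃_of_forall_exists_isBDPLFunction_min [Fact (Nat.Prime 3)]
    (hfact : ∀ (ι' : PadicAlgCl 3 ≃+* ℂ) (K : Type) [Field K] [NumberField K]
      (𝔭 : HeightOneSpectrum (𝓞 K)) (κ : ZpExtension K 3) (γ : Field.absoluteGaloisGroup K)
      {N : ℕ} [NeZero N] {f : CuspForm (CongruenceSubgroup.Gamma0 N) 2}, IsNewformOf W f →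
      ClassX11b W 3 → W.conductorNorm ℤ = N → W.HasIrreducibleModPGaloisRep 3 →
      IsImaginaryQuadratic K → ((Ideal.span {(3 : ℤ)}).primesOver (𝓞 K)).ncard = 2 →
      ((3 : ℕ) : 𝓞 K) ∈ 𝔭.asIdeal →
      (∀ (w : InfinitePlace K) (k : 𝓞 K), k ∈ 𝔭.asIdeal ↔ ‖ι'.symm (w.embedding (k : K))‖ < 1) →
      (∀ ℓ : ℕ, ℓ.Prime → ℓ ∣ N → ∃ v : HeightOneSpectrum (𝓞 K), Ideal.absNorm v.asIdeal = ℓ) →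
      κ.IsAnticyclotomic → κ.IsTopGenerator γ →
      ∃ (ΩK : ℂ) (Ωp : (unrIntegers 3)ˣ) (L : UnrSeries 3),
        ΩK ≠ 0 ∧ IsBDPLFunction ι' 𝔭 κ γ f ΩK ((Ωp : unrIntegers 3) : ℂ_[3]) L) :
    BDPExistsAt₃ W :=
  bdpExistsAt₃_of_forall_exists_isBDPLFunction W fun ι' K _ _ 𝔭 κ γ _ _ _ hnf hX _ hN hK _ _ h3 h𝔭
      _ _ hι' hHeeg hκ hγ ↦
    hfact ι' K 𝔭 κ γ hnf hX hN (hasIrreducibleModPGaloisRep_of_classX11b hX) hK h3 h𝔭 hι' hHeeg hκ hγ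

end Assembly

end Summit.BirchSwinnertonDyer.Rank1Residual.X11b.Three
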